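import Summits.Ventures.PercRepro.C026PassM

/-!
# Forests are D-free, part 1: acyclicity, carriers, the two claims (p6, gen 10)

mine-3's D-free inequality `DFreeIneq` (p5, `C026PassM.lean`, the τ-form
`#{S ∈ bot : a ~ b in δ(S)} ≤ #{S ∈ bot : τ₅₀(S) ∈ ac|b} + #{S ∈ bot : τ₁₈(S) ∈ bc|a}`) holds on every
ACYCLIC marked multigraph — in the one-sided form `#KL ≤ #A` — by one explicit injection
(proofs/P6-forest-dfree.md):

* `Acyclic` — no edge lies on a cycle: a closed edge never has its endpoints joined;
  (U1) `Acyclic.not_two_closed` — at most one closed edge between two clusters,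
  (U3) `Acyclic.not_conn_update_false` — every open edge is a bridge;
* `Carries ω x v` — `x` carries a closed edge into the cluster of `v`;
* **Claim 1** `Acyclic.exists_carrier`: on a `bot` configuration with `a ~ b` in `δ(S) = kSwap c S`
  some `x ∈ M` carries closed edges to both `K` and `L` (the set `K ∪ {y ∈ M : y carries to K} ∪ ⋃{clusters
  such a `y` carries to}` is closed under `δ(S)`-adjacency);
* **Claim 2** `cellAC_kSwapSealed_of_carries`: `c` carrying a closed edge to `K` puts `τ₅₀(S)` in `ac|b`;

The witness and its image are in `C026AcyclicDFree.lean`; the injection and THEOREM F in `C026AcyclicPhi.lean`.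
-/

namespace PercRepro

open Finset

namespace MultiGraph

variable {V E : Type*} (G : MultiGraph V E)

/-! ### Acyclicity through `Conn` -/

/-- **Acyclic**: no edge lies on a cycle — a closed edge never has its two endpoints joined by open
edges.  (Loops and parallel edges are excluded; on a forest every configuration satisfies this.) -/
def Acyclic : Prop := ∀ (ω : Config E) (e : E), ω e = false → ¬ G.Conn ω (G.fst e) (G.snd e)

/-- The edge `e` joins `x` and `z` (in either order). -/
def JoinsV (e : E) (x z : V) : Prop := (G.fst e = x ∧ G.snd e = z) ∨ (G.fst e = z ∧ G.snd e = x)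

variable {G}

/-- `JoinsV` is symmetric in the two vertices. -/
theorem JoinsV.symm {e : E} {x z : V} (h : G.JoinsV e x z) : G.JoinsV e z x := Or.symm h

/-- An open edge joining `x` and `z` makes them openly adjacent. -/
theorem openAdj_of_joinsV {ω : Config E} {e : E} {x z : V} (he : ω e = true) (h : G.JoinsV e x z) :
    G.OpenAdj ω x z :=
  ⟨e, he, h⟩

/-- The two endpoints of `e` as the pair `(x, z)` with `e` joining them: `e` joins its own endpoints. -/
theorem joinsV_fst_snd (e : E) : G.JoinsV e (G.fst e) (G.snd e) := Or.inl ⟨rfl, rfl⟩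

/-- (U3) **Every open edge is a bridge**: closing an open edge disconnects its endpoints. -/
theorem Acyclic.not_conn_update_false [DecidableEq E] (hG : G.Acyclic) {ω : Config E} {e : E} :
    ¬ G.Conn (Function.update ω e false) (G.fst e) (G.snd e) :=
  hG _ e (by simp)

/-- (U1) **At most one closed edge between two clusters**: two distinct closed edges whose endpoints are
joined pairwise would form a cycle. -/
theorem Acyclic.not_two_closed [DecidableEq E] (hG : G.Acyclic) {ω : Config E} {e e' : E}
    (he : ω e = false) (hne : e ≠ e')
    (h : (G.Conn ω (G.fst e) (G.fst e') ∧ G.Conn ω (G.snd e) (G.snd e')) ∨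
      (G.Conn ω (G.fst e) (G.snd e') ∧ G.Conn ω (G.snd e) (G.fst e'))) : False := by
  have hopen : (Function.update ω e' true) e' = true := by simp
  have hcl : (Function.update ω e' true) e = false := by
    rw [Function.update_of_ne hne]; exact he
  apply hG _ e hcl
  rcases h with ⟨h1, h2⟩ | ⟨h1, h2⟩
  · exact (h1.update_true.trans (Conn.of_openAdj (G.openAdj_of_open e' hopen))).trans h2.update_true.symm
  · exact (h1.update_true.trans (Conn.of_openAdj (G.openAdj_of_open e' hopen).symm)).trans
      h2.update_true.symm

/-- **Deletion lemma** (the contraction lemma read backwards): a path in `ω` through the open edge `e`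
either avoids `e` or reaches an endpoint of `e` first. -/
theorem conn_iff_update_false [DecidableEq E] {ω : Config E} {e : E} (he : ω e = true) (u v : V) :
    G.Conn ω u v ↔
      G.Conn (Function.update ω e false) u v ∨
        (G.Conn (Function.update ω e false) u (G.fst e) ∧
          G.Conn (Function.update ω e false) (G.snd e) v) ∨
        (G.Conn (Function.update ω e false) u (G.snd e) ∧
          G.Conn (Function.update ω e false) (G.fst e) v) := by
  have hω : ω = Function.update (Function.update ω e false) e true := by
    ext f
    by_cases hf : f = e
    · subst hf; simp [he]
    · simp [Function.update_of_ne hf]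
  conv_lhs => rw [hω]
  exact G.conn_update_true_iff _ e u v

/-- Connectivity between two vertices avoiding one closed edge transfers when the edge is irrelevant:
an open path of `ω` all of whose edges differ from `e` is a path of `update ω e false`. -/
theorem Conn.update_false_of_forall [DecidableEq E] {ω : Config E} {e : E} {u v : V}
    (h : G.Conn ω u v) (P : V → Prop) (hu : P u)
    (hP : ∀ w w' (f : E), P w → ω f = true → G.JoinsV f w w' → f ≠ e ∧ P w') :
    G.Conn (Function.update ω e false) u v ∧ P v := by
  refine Conn.induction (motive := fun w => G.Conn (Function.update ω e false) u w ∧ P w)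
    ⟨Conn.refl G _ u, hu⟩ (fun {w w'} _ hww' ih => ?_) h
  obtain ⟨f, hf, hend⟩ := hww'
  obtain ⟨hfe, hw'⟩ := hP w w' f ih.2 hf hend
  refine ⟨ih.1.trans (Conn.of_openAdj ⟨f, ?_, hend⟩), hw'⟩
  rw [Function.update_of_ne hfe]; exact hf

/-- Two descriptions of the endpoints of one edge agree up to order. -/
theorem JoinsV.eq_or_eq {e : E} {x z x' z' : V} (h : G.JoinsV e x z) (h' : G.JoinsV e x' z') :
    (x = x' ∧ z = z') ∨ (x = z' ∧ z = x') := by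
  rcases h with ⟨h1, h2⟩ | ⟨h1, h2⟩ <;> rcases h' with ⟨h3, h4⟩ | ⟨h3, h4⟩
  · exact Or.inl ⟨h1.symm.trans h3, h2.symm.trans h4⟩
  · exact Or.inr ⟨h1.symm.trans h3, h2.symm.trans h4⟩
  · exact Or.inr ⟨h2.symm.trans h4, h1.symm.trans h3⟩
  · exact Or.inl ⟨h2.symm.trans h4, h1.symm.trans h3⟩

/-- `u ↔ v` along the endpoints of `e` in either order. -/
theorem conn_fst_snd_iff {ω : Config E} {e : E} {x z : V} (h : G.JoinsV e x z) :
    G.Conn ω (G.fst e) (G.snd e) ↔ G.Conn ω x z := by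
  rcases h with ⟨rfl, rfl⟩ | ⟨rfl, rfl⟩
  · exact Iff.rfl
  · exact conn_comm

/-- (U2) A closed edge never joins two connected vertices. -/
theorem Acyclic.not_conn_of_closed (hG : G.Acyclic) {ω : Config E} {e : E} {x z : V}
    (he : ω e = false) (h : G.JoinsV e x z) : ¬ G.Conn ω x z := fun hc =>
  hG ω e he ((G.conn_fst_snd_iff h).2 hc)

/-- (U1) in the `JoinsV` form: two distinct closed edges `e` (joining `x, z`) and `e'` (joining `x', z'`)
with `x ↔ x'` and `z ↔ z'` cannot coexist. -/
theorem Acyclic.not_two_closed' [DecidableEq E] (hG : G.Acyclic) {ω : Config E} {e e' : E}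
    {x z x' z' : V} (he : ω e = false) (hne : e ≠ e') (h : G.JoinsV e x z) (h' : G.JoinsV e' x' z')
    (hx : G.Conn ω x x') (hz : G.Conn ω z z') : False := by
  refine hG.not_two_closed he hne ?_
  rcases h with ⟨rfl, rfl⟩ | ⟨rfl, rfl⟩ <;> rcases h' with ⟨rfl, rfl⟩ | ⟨rfl, rfl⟩
  · exact Or.inl ⟨hx, hz⟩
  · exact Or.inr ⟨hx, hz⟩
  · exact Or.inr ⟨hz, hx⟩
  · exact Or.inl ⟨hz, hx⟩

/-- Closing one edge is monotone in the configuration. -/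
theorem update_false_mono [DecidableEq E] {ω ω' : Config E} (h : ω ≤ ω') (e : E) :
    Function.update ω e false ≤ Function.update ω' e false := by
  intro f
  by_cases hf : f = e
  · subst hf; simp
  · simp only [Function.update_of_ne hf]; exact h f

/-- (L4) **The first edge of an open path**: if `c ↔ x` and `x ≠ c`, some open edge `e₁` at `c` leads to a
vertex `y₁` from which `x` is reached without `e₁`. -/
theorem exists_first_edge [DecidableEq E] {ω : Config E} {c x : V} (h : G.Conn ω c x) (hx : x ≠ c) :
    ∃ e₁ y₁, ω e₁ = true ∧ G.JoinsV e₁ c y₁ ∧ G.Conn (Function.update ω e₁ false) y₁ x := by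
  have key : x = c ∨ ∃ e₁ y₁, ω e₁ = true ∧ G.JoinsV e₁ c y₁ ∧
      G.Conn (Function.update ω e₁ false) y₁ x := by
    refine Conn.induction (motive := fun x => x = c ∨ ∃ e₁ y₁, ω e₁ = true ∧ G.JoinsV e₁ c y₁ ∧
      G.Conn (Function.update ω e₁ false) y₁ x) (Or.inl rfl) (fun {w w'} _ hww' ih => ?_) h
    obtain ⟨k, hk, hend⟩ := hww'
    rcases ih with rfl | ⟨e₁, y₁, he₁, hj, hc⟩
    · exact Or.inr ⟨k, w', hk, hend, Conn.refl G _ w'⟩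
    · by_cases hke : k = e₁
      · subst hke
        rcases JoinsV.eq_or_eq hend hj with ⟨-, h⟩ | ⟨-, h⟩
        · exact Or.inr ⟨k, y₁, he₁, hj, by rw [h]; exact Conn.refl G _ y₁⟩
        · exact Or.inl h
      · refine Or.inr ⟨e₁, y₁, he₁, hj, hc.trans (Conn.of_openAdj ⟨k, ?_, hend⟩)⟩
        rw [Function.update_of_ne hke]; exact hk
  exact key.resolve_left hx

/-- (L6) **The separating edge at `x` is unique**: two distinct open edges at `x` cannot both disconnect
`a` from `x` when closed. -/
theorem Acyclic.sep_edge_unique [DecidableEq E] (hG : G.Acyclic) {ω : Config E} {a x u u' : V}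
    {f f' : E} (hf : ω f = true) (hf' : ω f' = true) (hjf : G.JoinsV f x u) (hjf' : G.JoinsV f' x u')
    (hsep : ¬ G.Conn (Function.update ω f false) a x)
    (hsep' : ¬ G.Conn (Function.update ω f' false) a x) (hax : G.Conn ω a x) : f = f' := by
  by_contra hne
  -- the path from `a` to `x` reaches `u` before using `f`
  have h1 : G.Conn (Function.update ω f false) a u := by
    rcases (G.conn_iff_update_false hf a x).1 hax with h | ⟨h1, -⟩ | ⟨h1, -⟩
    · exact absurd h hsep
    · rcases hjf with ⟨hx, -⟩ | ⟨hu, -⟩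
      · rw [hx] at h1; exact absurd h1 hsep
      · rw [hu] at h1; exact h1
    · rcases hjf with ⟨-, hu⟩ | ⟨-, hx⟩
      · rw [hu] at h1; exact h1
      · rw [hx] at h1; exact absurd h1 hsep
  have hf'1 : (Function.update ω f false) f' = true := by
    rw [Function.update_of_ne (Ne.symm hne)]; exact hf'
  have hmono : Function.update (Function.update ω f false) f' false ≤ Function.update ω f' false :=
    update_false_mono (update_false_le ω f) f'
  have hf3 : (Function.update (Function.update ω f false) f' false) f = false := by
    rw [Function.update_of_ne hne]; simp
  -- and the path from `a` to `u` (without `f`) either avoids `f'` or reaches an endpoint of `f'`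
  rcases (G.conn_iff_update_false hf'1 a u).1 h1 with h | ⟨h2, h3⟩ | ⟨h2, h3⟩
  · -- avoids `f'`: then `a ↔ u ↔ x` through `f` without `f'`
    apply hsep'
    refine (h.mono hmono).trans (Conn.of_openAdj ⟨f, ?_, hjf.symm⟩)
    rw [Function.update_of_ne hne]; exact hf
  · rcases hjf' with ⟨hx', -⟩ | ⟨-, hx'⟩
    · rw [hx'] at h2; exact hsep (h2.mono (update_false_le _ f'))
    · rw [hx'] at h3
      exact hG.not_conn_of_closed hf3 hjf h3
  · rcases hjf' with ⟨hx', -⟩ | ⟨-, hx'⟩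
    · rw [hx'] at h3
      exact hG.not_conn_of_closed hf3 hjf h3
    · rw [hx'] at h2; exact hsep (h2.mono (update_false_le _ f'))

/-! ### Carriers -/

variable (G) in
/-- `x` **carries** a closed edge to the cluster of `v`: some closed edge joins `x` and a vertex joined to
`v`. -/
def Carries (ω : Config E) (x v : V) : Prop :=
  ∃ e z, ω e = false ∧ G.JoinsV e x z ∧ G.Conn ω v z

/-- `Carries` depends on the cluster of `v` only. -/
theorem Carries.of_conn {ω : Config E} {x v v' : V} (h : G.Carries ω x v) (hvv' : G.Conn ω v v') :
    G.Carries ω x v' := by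
  obtain ⟨e, z, he, hj, hz⟩ := h
  exact ⟨e, z, he, hj, hvv'.symm.trans hz⟩

/-- **Claim 1**: on an acyclic multigraph, a `bot` configuration with `a ↔ b` in the `M`-flip has a vertex
`x` of `M` carrying closed edges to both `K` and `L`. -/
theorem Acyclic.exists_carrier [DecidableEq E] (hG : G.Acyclic) {S : Config E} {a b c : V}
    (hbot : G.IsBot S a b c) (hKL : G.Conn (G.kSwap c S) a b) :
    ∃ x, G.Conn S c x ∧ G.Carries S x a ∧ G.Carries S x b := by
  classical
  obtain ⟨hab, hac, hbc⟩ := hbot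
  let R : V → Prop := fun u => G.Conn S a u ∨ (G.Conn S c u ∧ G.Carries S u a) ∨
    (¬ G.Conn S c u ∧ ∃ y, G.Conn S c y ∧ G.Carries S y a ∧ G.Carries S y u)
  have hRb : R b := by
    refine Conn.induction (motive := R) (Or.inl (Conn.refl G S a)) (fun {u u'} _ huu' hu => ?_) hKL
    obtain ⟨f, hf, hend⟩ := huu'
    have hend' : G.JoinsV f u u' := hend
    by_cases hfM : f ∈ G.edgesAt (G.cluster S c)
    · -- the edge is at `M`, hence closed in `S` and flipped open
      have hSf : S f = false := by
        have h1 := G.kSwap_apply_of_mem hfM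
        rw [hf] at h1
        cases h2 : S f
        · rfl
        · rw [h2] at h1; exact absurd h1 (by decide)
      by_cases hcu : G.Conn S c u
      · -- `u ∈ M`: `u` carries to `K`; `u' ∉ M`
        have hcar : G.Carries S u a := by
          rcases hu with h | ⟨-, h⟩ | ⟨h, -⟩
          · exact absurd (h.trans hcu.symm) hac
          · exact h
          · exact absurd hcu h
        have hcu' : ¬ G.Conn S c u' := fun hcu' =>
          hG.not_conn_of_closed hSf hend' (hcu.symm.trans hcu')
        by_cases hau' : G.Conn S a u'
        · exact Or.inl hau'
        · exact Or.inr (Or.inr ⟨hcu', u, hcu, hcar, ⟨f, u', hSf, hend', Conn.refl G S u'⟩⟩)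
      · -- `u ∉ M`, so `u' ∈ M`
        have hcu' : G.Conn S c u' := by
          rcases hend' with ⟨h1, h2⟩ | ⟨h1, h2⟩ <;> rcases hfM with h3 | h3 <;>
            simp only [mem_cluster] at h3
          · rw [h1] at h3; exact absurd h3 hcu
          · rw [h2] at h3; exact h3
          · rw [h1] at h3; exact h3
          · rw [h2] at h3; exact absurd h3 hcu
        rcases hu with h | ⟨h, -⟩ | ⟨-, y, hcy, hya, g, z, hg, hjg, huz⟩
        · exact Or.inr (Or.inl ⟨hcu', f, u, hSf, hend'.symm, h⟩)
        · exact absurd h hcu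
        · -- `u' = y`
          have hu'y : u' = y := by
            by_cases hfg : f = g
            · subst hfg
              rcases JoinsV.eq_or_eq hend' hjg with ⟨h1, -⟩ | ⟨-, h2⟩
              · exact absurd (h1 ▸ hcy) hcu
              · exact h2
            · exact absurd (hG.not_two_closed' hSf hfg hend'.symm hjg (hcu'.symm.trans hcy) huz)
                id
          subst hu'y
          exact Or.inr (Or.inl ⟨hcu', hya⟩)
    · -- the edge is away from `M`: open in `S`, both endpoints away from `M`
      have hSf : S f = true := by rw [← G.kSwap_apply_of_notMem hfM]; exact hf
      have huu' : G.Conn S u u' := Conn.of_openAdj ⟨f, hSf, hend⟩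
      have hcu : ¬ G.Conn S c u := fun h => hfM (by
        rcases hend' with ⟨h1, -⟩ | ⟨-, h2⟩
        · exact Or.inl (by rw [h1]; exact h)
        · exact Or.inr (by rw [h2]; exact h))
      have hcu' : ¬ G.Conn S c u' := fun h => hcu (h.trans huu'.symm)
      rcases hu with h | ⟨h, -⟩ | ⟨-, y, hcy, hya, hyu⟩
      · exact Or.inl (h.trans huu')
      · exact absurd h hcu
      · exact Or.inr (Or.inr ⟨hcu', y, hcy, hya, hyu.of_conn huu'⟩)
  rcases hRb with h | ⟨h, -⟩ | ⟨-, y, hcy, hya, hyb⟩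
  · exact absurd h hab
  · exact absurd h.symm hbc
  · exact ⟨y, hcy, hya, hyb⟩

/-! ### Claim 2: a carrier at `c` puts the sealed flip into `ac|b` -/

/-- The sealed flip `τ₅₀ = kSwapSealed c b` never joins `a` to `b`: the boundary of `L` stays closed. -/
theorem not_conn_kSwapSealed_of_not_conn {S : Config E} {a b c : V} (hab : ¬ G.Conn S a b) :
    ¬ G.Conn (G.kSwapSealed c b S) a b := by
  classical
  intro h
  have hcut : ∀ e, G.kSwapSealed c b S e = true →
      (G.fst e ∈ G.cluster S b ↔ G.snd e ∈ G.cluster S b) := by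
    intro e he
    by_cases hL : e ∈ G.edgesAt (G.cluster S b)
    · have hSe : S e = true := by rw [← G.kSwapSealed_apply_of_mem_c hL]; exact he
      exact ⟨fun h1 => G.snd_mem_cluster_of_open hSe h1, fun h2 => G.fst_mem_cluster_of_open hSe h2⟩
    · rw [mem_edgesAt, not_or] at hL
      exact ⟨fun h1 => absurd h1 hL.1, fun h2 => absurd h2 hL.2⟩
  exact hab ((mem_cluster G).1 (G.mem_of_conn_of_closed_boundary hcut (G.self_mem_cluster S b) h.symm)).symm

/-- An open edge at the cluster of `a` is not at the cluster of `c` when `a ≁ c`. -/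
theorem not_mem_edgesAt_cluster_of_open_of_not_conn {S : Config E} {a c : V} (hac : ¬ G.Conn S a c)
    {f : E} (hf : S f = true) (hfK : f ∈ G.edgesAt (G.cluster S a)) :
    f ∉ G.edgesAt (G.cluster S c) := by
  intro hfM
  have hK1 : G.fst f ∈ G.cluster S a := by
    rcases hfK with h | h
    · exact h
    · exact G.fst_mem_cluster_of_open hf h
  have hK2 : G.snd f ∈ G.cluster S a := G.snd_mem_cluster_of_open hf hK1
  rcases hfM with h | h
  · exact hac (((mem_cluster G).1 hK1).trans ((mem_cluster G).1 h).symm)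
  · exact hac (((mem_cluster G).1 hK2).trans ((mem_cluster G).1 h).symm)

/-- **Claim 2 (⇐)**: on a `bot` configuration in which `c` carries a closed edge to `K`, the sealed flip
`τ₅₀(S)` lies in the cell `ac|b`. -/
theorem cellAC_kSwapSealed_of_carries {S : Config E} {a b c : V} (hbot : G.IsBot S a b c)
    (hcar : G.Carries S c a) : G.CellAC (G.kSwapSealed c b S) a b c := by
  classical
  obtain ⟨hab, hac, hbc⟩ := hbot
  obtain ⟨e, z, he, hj, haz⟩ := hcar
  refine ⟨?_, G.not_conn_kSwapSealed_of_not_conn hab⟩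
  have hM : e ∈ G.edgesAt (G.cluster S c) := by
    rcases hj with ⟨h1, -⟩ | ⟨-, h2⟩
    · exact Or.inl (by rw [h1]; exact G.self_mem_cluster S c)
    · exact Or.inr (by rw [h2]; exact G.self_mem_cluster S c)
  have hL : e ∉ G.edgesAt (G.cluster S b) := by
    intro hL
    rcases hj with ⟨h1, h2⟩ | ⟨h1, h2⟩ <;> rcases hL with h3 | h3 <;> simp only [mem_cluster] at h3
    · rw [h1] at h3; exact hbc h3
    · rw [h2] at h3; exact hab (haz.trans h3.symm)
    · rw [h1] at h3; exact hab (haz.trans h3.symm)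
    · rw [h2] at h3; exact hbc h3
  have hτe : G.kSwapSealed c b S e = true := by
    rw [G.kSwapSealed_apply_of_flip hM hL, he]; rfl
  have hza : G.Conn (G.kSwapSealed c b S) a z := by
    refine G.conn_of_open_edges (ω := S) (v := a) ?_ haz
    intro f hf hfK
    rw [G.kSwapSealed_apply_of_notMem (G.not_mem_edgesAt_cluster_of_open_of_not_conn hac hf hfK)]
    exact hf
  exact hza.trans (Conn.of_openAdj ⟨e, hτe, hj.symm⟩)

end MultiGraph

end PercRepro
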